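import Summits.BirchSwinnertonDyer.BirchSwinnertonDyer.Theorems.ByReductionTypeAtTwoOrdKatoHalfAtTwoIsoZetaColemanMuDefs
import Literature.NumberTheory.EllipticCurves.Sprung2012.SharpFlatSelmerDualRestrictionProofs
import Literature.NumberTheory.EllipticCurves.IwasawaDualFunctorialityProofs
import Mathlib.Algebra.Module.CharacterModule
import HarnessLib

/-!
# Route ByReductionTypeAtTwo, crux `OrdKatoHalfAtTwoIso` (stmt-BirchSwinnertonDyer-19573), line
# `steinberg-fibre-at-two`, RE-CUT SOCKET 2 (F1μ, p678187): the SELMER SIDE of Kato's zeta classes in Coleman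
# coordinates at `p = 2` is KERNEL — the fine quotient `π : X ↠ X₀`, the exactness `P → X → X₀` and the `∀ Y` of
# `SteinbergFibreAtTwo.HasZetaColemanMuInputsAtTwo` are Pontryagin-duality bookkeeping on the tree's pinned duals

Seat `cruxlead-stmt-BirchSwinnertonDyer-19573-w3` (prover WIDTH under the LEAD `cruxlead-19573` g4; HOME
`run/shared/lean/pub/bsd-2adic/`; `--supports` stmt-BirchSwinnertonDyer-23760 `OrdKatoFineZetaAtTwoResidue`, to be re-typed to
the F1μ text `SteinbergFibreAtTwo.ZetaColemanMuInputsNegDiscAtTwo` — this file serves both texts, the registered one through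
`hasZetaColemanMuInputsAtTwo_of_divisibilityInputs`). HONEST FRAMING (cell bsd-2adic): BSD is not proved by any of this; the
crux and the socket are NOT proved here; nothing is asserted — every theorem below is a KERNEL implication over explicit
hypotheses, no definition, no named fact, no `sorry`.

WHY THIS FILE. The per-datum reading `HasZetaColemanMuInputsAtTwo W f κ γ hκ D Y` (p678187, the re-cut socket 2 of the
line; Kato §17.13 at `2` read on the `μ`-part) asks for SIX objects `I, Z, P ⊆ Λ, ℓ, τ, π` with five clauses: (a) the Thm.
12.6 span clause, (b) `τ (ℓ z) = 0` on `Z` (half of the exactness of (17.13.1) at `P`), (c) `π : X ↠ X₀` onto, (d)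
`Function.Exact τ π` ((14.9.3): the cokernel of `P → X` is the dual FINE Selmer group), (e) the zeta image clause at `(2)`.
Of these, (c), (d) and the bookkeeping half of (b) are NOT Kato's machine: they are Pontryagin duality on the tree's PINNED
duals `D : W.SelmerDualData κ γ` (`X = Hom(Sel_{2^∞}(E/ℚ_∞), ℚ/ℤ)`) and `Y : W.FineSelmerDualData κ γ`
(`X₀ = Hom(Sel₀(ℚ_∞, E[2^∞]), ℚ/ℤ)`), once `τ` is what it is in print — the TRANSPOSE of the localisation of Selmer
classes at the prime above `2` — and `P` is what it is in print — the Pontryagin dual of the local condition group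
`H¹_f(ℚ_{∞,2}, E[2^∞])` put in Coleman coordinates by Prop. 17.11. This file proves exactly that, so that after it the
per-datum socket follows from Kato's machine AT `2` ALONE, stated in coordinates (§3, hypotheses of
`hasZetaColemanMuInputsAtTwo_of_localDualPair`):

* (L) a LOCAL COLEMAN DUAL PAIR at `2`: an abstract `Λ`-module `P₀` in axiomatic Pontryagin duality
  (`IwasawaDual.IsDualPair 2 ψ toDualP`) with an abelian group `S` carrying an endomorphism `ψ` — in print
  `S = H¹_f(ℚ_{∞,2}, E[2^∞]) = E(ℚ_{∞,2}) ⊗ ℚ₂/ℤ₂`, `ψ = γ − 1`, `P₀ = 𝐇¹_loc(T)/𝐇¹_loc(T') = H¹_s` ((17.13.3) with 17.9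
  and Λ-adic local Tate duality) — together with an INJECTIVE `Λ`-linear `col : P₀ → Λ` (Prop. 17.11 at `2`, the Coleman /
  Perrin-Riou map `𝔏_η`) and an additive `φ : Sel_{2^∞}(E/ℚ_∞) → S` intertwining `conj_γ − 1` with `ψ` whose kernel is
  EXACTLY `Sel₀(ℚ_∞, E[2^∞])` — in print `φ = loc₂` (Selmer classes over `ℚ_∞` are locally trivial away from `2` and at `∞`,
  so `ker loc₂|_{Sel} = Sel₀`; Kim AJM 148 §1.2.4, Kato (14.9.3));
* (R) GLOBAL RECIPROCITY in coordinates: a `Λ`-linear `ℓ₀ : 𝐇¹_Γ(T₂W) → P₀` (singular localisation at `2`) with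
  `toDualP (ℓ₀ z) (φ s) = 0` for `z ∈ Z`, `s ∈ Sel` — in print `⟨loc₂ z, loc₂ s⟩₂ = −∑_{v ≠ 2} ⟨loc_v z, loc_v s⟩_v = 0`
  (Poitou–Tate; the archimedean term vanishes on the line's habitat `Δ_W < 0`, where `T₂E ≅ ℤ₂[Gal(ℂ/ℝ)]` is induced);
* (E) the ZETA IMAGE CLAUSE at `(2)`: for `G₁ ∈ Λ` with `ι G₁ = L₂(f, α)` some `s ∉ (2)` has `s·G₁ ∈ col(ℓ₀ Z)` (Thm. 16.6
  (2) + 12.6 + the `2`-adic period unit, Abbes–Ullmo) — unchanged from p678187; §2 gives its one-class form.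

THE KERNEL CONTENT (§1): for ANY three «dual pairs» — only bijectivity / injectivity / surjectivity of the three `toDual`
maps is used — with `ι₀ : S₀ ↪ S` (here `Sel₀ ≤ Sel`), `φ : S → S_P` with `ker φ = range ι₀`, `π` the transpose of `ι₀`
and `τ` the transpose of `φ`, the sequence `P —τ→ X —π→ X₀` is EXACT (`exact_transpose_of_ker_eq_range`): `π ∘ τ = 0`
because `φ ∘ ι₀ = 0`, and a character of `S` killing `range ι₀ = ker φ` factors through `S/ker φ ↪ S_P` and extends to
`S_P` because `ℚ/ℤ` is an injective `ℤ`-module (Mathlib `CharacterModule.dual_surjective_of_injective`). With the tree's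
canonical `π : X ↠ X₀` (`WeierstrassCurve.FineSelmerDualData.exists_linearMap_ofSelmerDual`, any key `γ`) and the
transpose `τ₀ : P₀ → X` of `φ` (`IwasawaDual.IsDualPair.exists_linearMap_comp`, `Λ`-LINEAR by the `𝔪`-adic argument of
that file), clauses (b)(c)(d) follow, and `P := range col`, `ℓ := col ∘ ℓ₀`, `τ := τ₀ ∘ col⁻¹` give the socket
(§3 `hasZetaColemanMuInputsAtTwo_of_localDualPair`; §4 the ∀-form `zetaColemanMuInputsNegDiscAtTwo_of_localDualPairs`).
CONSEQUENCE FOR THE ITEM: the `∀ Y` of the socket is free (the hypotheses do not mention `Y`), and the beyond-print content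
of F1μ is exactly (L) + (R) + (E) — the local Coleman theory of `T₂E` at the ordinary prime `2` over `ℚ₂(ζ_{2^{n+2}})⁺`,
one reciprocity sum, and the explicit reciprocity law at `(2)`; the Selmer-group side ((14.9.3), MEMO-5′ Δ8 / conjuncts)
is no longer part of it.

References: [Kato2004Asterisque] Thm. 12.6 (p. 222), (14.9.3) (p. 240), Thm. 16.6 (p. 271), 17.9, Prop. 17.11 (p. 277),
§17.13 (pp. 279–280); [Kim2022StructureSelmer] §1.2.4; [GreenbergLNM1716] §1 p. 60; [MilneADT2006] I Thm. 4.10;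
HOME `bsd-2adic-cruxlead19573-MEMO-5PRIME.md` (F2 at `P`, Δ8, conjuncts); tree `…OrdKatoHalfAtTwoIsoZetaColemanMuDefs.lean`
(p678187), `IwasawaDualFunctorialityProofs.lean`, `Sprung2012/SharpFlatSelmerDualRestrictionProofs.lean`.
-/

set_option autoImplicit false
set_option linter.dupNamespace false

noncomputable section

open scoped Classical MatrixGroups ModularForm NumberField
open CongruenceSubgroup WeierstrassCurve Field IsDedekindDomain
open Literature.NumberTheory.GaloisRepresentations
open Literature.NumberTheory.EllipticCurves Literature.NumberTheory.EllipticCurves.ModularForms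
open Literature.NumberTheory.EllipticCurves.Kato2004
  Literature.NumberTheory.EllipticCurves.Kato2004.EulerSystemValues
open Literature.NumberTheory.EllipticCurves.IwasawaDual
open Summit.BirchSwinnertonDyer.Rank1Residual Summit.BirchSwinnertonDyer.Rank1Residual.X5
open Summit.BirchSwinnertonDyer.BirchSwinnertonDyer.Theses.ByReductionTypeAtTwo

namespace Summit.BirchSwinnertonDyer.BirchSwinnertonDyer.Theorems.SteinbergFibreAtTwo

/-! ## §1 Pontryagin duality: the transpose of `S₀ ↪ S → S_P` (kernel = image) is exact -/

section Duality

variable {S : Type*} [AddCommGroup S] {X : Type*} [AddCommGroup X] {toDual : X →+ (S →+ AddCircle (1 : ℚ))}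
variable {S₀ : Type*} [AddCommGroup S₀] {X₀ : Type*} [AddCommGroup X₀] {toDual₀ : X₀ →+ (S₀ →+ AddCircle (1 : ℚ))}
variable {SP : Type*} [AddCommGroup SP] {P : Type*} [AddCommGroup P] {toDualP : P →+ (SP →+ AddCircle (1 : ℚ))}

/-- **A character killing the kernel of `φ : S → S_P` extends along `φ`** (`ℚ/ℤ` is an injective `ℤ`-module): if
`χ : S → ℚ/ℤ` vanishes on `ker φ` there is `χ' : S_P → ℚ/ℤ` with `χ' (φ s) = χ s`. Factor `χ` through `S/ker φ`
(`QuotientAddGroup.lift`), embed `S/ker φ ↪ S_P` (`QuotientAddGroup.kerLift`, injective) and extend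
(`CharacterModule.dual_surjective_of_injective`). [folklore] -/
theorem exists_character_comp_eq_of_ker_le (φ : S →+ SP) (χ : S →+ AddCircle (1 : ℚ))
    (hχ : ∀ s, φ s = 0 → χ s = 0) : ∃ χ' : SP →+ AddCircle (1 : ℚ), ∀ s, χ' (φ s) = χ s := by
  have hle : φ.ker ≤ χ.ker := fun s hs => (AddMonoidHom.mem_ker).2 (hχ s ((AddMonoidHom.mem_ker).1 hs))
  obtain ⟨χ', hχ'⟩ := CharacterModule.dual_surjective_of_injective (R := ℤ)
    (QuotientAddGroup.kerLift φ).toIntLinearMap (QuotientAddGroup.kerLift_injective φ)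
    (QuotientAddGroup.lift φ.ker χ hle)
  refine ⟨χ', fun s => ?_⟩
  -- `(dual (kerLift φ) χ') (mk s) = χ' (φ s)` and `lift φ.ker χ hle (mk s) = χ s`, both definitionally
  exact congrArg (fun c : CharacterModule (S ⧸ φ.ker) => c (QuotientAddGroup.mk s)) hχ'

/-- **The transpose of `S₀ ↪ S → S_P` with `ker φ = range ι₀` is exact at `X`.** Let `toDual : X ≃ Hom(S, ℚ/ℤ)` be
bijective, `toDual₀ : X₀ → Hom(S₀, ℚ/ℤ)` injective, `toDualP : P → Hom(S_P, ℚ/ℤ)` onto; let `ι₀ : S₀ → S`, `φ : S → S_P`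
with `φ s = 0 ↔ s ∈ range ι₀`; let `π : X → X₀` be a transpose of `ι₀` (`toDual₀ (π x) s₀ = toDual x (ι₀ s₀)`) and
`τ : P → X` a transpose of `φ` (`toDual (τ u) s = toDualP u (φ s)`). Then `Function.Exact τ π`: `π (τ u) = 0` since
`φ ∘ ι₀ = 0`; and if `π x = 0` the character `toDual x` kills `range ι₀ = ker φ`, so it is `χ' ∘ φ` for a character
`χ' = toDualP u` of `S_P`, whence `x = τ u`. This is the exactness of `Hom(−, ℚ/ℤ)` on `S₀ → S → S/S₀ ↪ S_P` — the
algebra under Kato's (14.9.3) «`Coker(P → 𝔛)` is the dual of the Selmer classes with trivial image at `p`».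
[cite: Kato2004Asterisque, (14.9.3) (p. 240)] [cite: GreenbergLNM1716, §1 p. 60] -/
theorem exact_transpose_of_ker_eq_range (hX : Function.Bijective toDual) (hX₀ : Function.Injective toDual₀)
    (hP : Function.Surjective toDualP) (ι₀ : S₀ →+ S) (φ : S →+ SP) (hker : ∀ s, φ s = 0 ↔ s ∈ ι₀.range)
    {π : X → X₀} (hπ : ∀ x s₀, toDual₀ (π x) s₀ = toDual x (ι₀ s₀))
    {τ : P → X} (hτ : ∀ u s, toDual (τ u) s = toDualP u (φ s)) : Function.Exact τ π := by
  intro x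
  constructor
  · intro hx
    -- `toDual x` kills `range ι₀ = ker φ`
    have hvan : ∀ s, φ s = 0 → toDual x s = 0 := by
      intro s hs
      obtain ⟨s₀, rfl⟩ := AddMonoidHom.mem_range.1 ((hker s).1 hs)
      rw [← hπ, hx, map_zero, AddMonoidHom.zero_apply]
    obtain ⟨χ', hχ'⟩ := exists_character_comp_eq_of_ker_le φ (toDual x) hvan
    obtain ⟨u, hu⟩ := hP χ'
    refine ⟨u, hX.1 ?_⟩
    ext s
    rw [hτ, hu, hχ']
  · rintro ⟨u, rfl⟩
    apply hX₀
    rw [map_zero]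
    ext s₀
    rw [hπ, hτ, (hker (ι₀ s₀)).2 (AddMonoidHom.mem_range.2 ⟨s₀, rfl⟩), map_zero,
      AddMonoidHom.zero_apply]

/-- **Half of the exactness at `P` from reciprocity in coordinates**: if `toDual` is injective, `τ` is a transpose of
`φ`, and `toDualP v (φ s) = 0` for every `s`, then `τ v = 0`. In print: a global Iwasawa class `z` pairs to zero with
every Selmer class at `2` (`∑_v ⟨z_v, s_v⟩_v = 0` and the terms at `v ≠ 2` vanish), so `loc₂^s z` dies in `X(E/ℚ_∞)`.
[cite: Kato2004Asterisque, §17.13 (17.13.1) (p. 279)] [cite: MilneADT2006, Ch. I, Thm. 4.10(b)] -/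
theorem transpose_eq_zero_of_pairing_eq_zero (hX : Function.Injective toDual) (φ : S →+ SP)
    {τ : P → X} (hτ : ∀ u s, toDual (τ u) s = toDualP u (φ s)) {v : P} (hv : ∀ s, toDualP v (φ s) = 0) :
    τ v = 0 := by
  apply hX
  rw [map_zero]
  ext s
  rw [hτ, hv, AddMonoidHom.zero_apply]

/-- **Reciprocity on GENERATORS suffices.** If `toDual` is injective and `τ : P → X` is a `Λ`-LINEAR transpose of `φ`
(`toDual (τ u) s = toDualP u (φ s)`), then the coordinates `v ∈ P` pairing to zero with `φ(S)` are exactly `ker τ`, a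
`Λ`-submodule; hence if `toDualP (ℓ₀ g) (φ s) = 0` for the members `g` of a set `G ⊆ 𝐇¹` (the lifted `(c, d)`-zeta
classes), the same holds for every `z` in their `Λ`-span `Z`. In print: the reciprocity law is checked class by class
on Kato's systems and propagates to `Z = Λ·{z_{c,d}}` by linearity of the Λ-adic pairing.
[cite: Kato2004Asterisque, Thm. 12.6 (p. 222), §17.13 (p. 279)] [cite: MilneADT2006, Ch. I, Thm. 4.10(b)] -/
theorem pairing_eq_zero_of_mem_span {Λ : Type*} [Semiring Λ] [Module Λ X] [Module Λ P]
    {H : Type*} [AddCommGroup H] [Module Λ H] (hX : Function.Injective toDual) (φ : S →+ SP)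
    {τ : P →ₗ[Λ] X} (hτ : ∀ u s, toDual (τ u) s = toDualP u (φ s)) (ℓ₀ : H →ₗ[Λ] P) {G : Set H}
    (hG : ∀ g ∈ G, ∀ s, toDualP (ℓ₀ g) (φ s) = 0) {z : H} (hz : z ∈ Submodule.span Λ G) (s : S) :
    toDualP (ℓ₀ z) (φ s) = 0 := by
  have hker : Submodule.span Λ G ≤ LinearMap.ker (τ ∘ₗ ℓ₀) := by
    rw [Submodule.span_le]
    intro g hg
    rw [SetLike.mem_coe, LinearMap.mem_ker, LinearMap.comp_apply]
    exact transpose_eq_zero_of_pairing_eq_zero hX φ hτ (hG g hg)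
  have h0 : τ (ℓ₀ z) = 0 := by
    have := hker hz
    rwa [LinearMap.mem_ker, LinearMap.comp_apply] at this
  rw [← hτ, h0, map_zero, AddMonoidHom.zero_apply]

end Duality

/-! ## §2 The zeta image clause at `(2)` from ONE class (Thm. 12.6 / 16.6 (2) shape) -/

section Image

variable {H : Type*} [AddCommGroup H] [Module (IwasawaAlgebra 2) H]
  {P₀ : Type*} [AddCommGroup P₀] [Module (IwasawaAlgebra 2) P₀]

/-- **The image clause at `(2)` from one zeta class.** If some `z ∈ Z` has Coleman coordinate `col (ℓ₀ z) = s·G₁` with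
`s ∉ (2)` — in print: ONE integral `(c, d)`-zeta system whose multiplier
`(c² − cσ_c)(d² − dσ_d)·∏(1 − ā_ℓ ℓ⁻¹σ_ℓ⁻¹)` has `μ`-invariant `0`, times the `2`-adic period unit (Thm. 16.6 (2) with
17.5/17.11; MEMO-5′ Δ9/R4) — then `s·G₁ ∈ col(ℓ₀ Z)` with `s ∉ (2)`, the clause (e) of the socket.
[cite: Kato2004Asterisque, Thm. 12.6 (p. 222), Thm. 16.6 (2) (p. 271), §17.13 (p. 280)] -/
theorem imageClauseAtTwo_of_single_class (Z : Submodule (IwasawaAlgebra 2) H)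
    (col : P₀ →ₗ[IwasawaAlgebra 2] IwasawaAlgebra 2) (ℓ₀ : H →ₗ[IwasawaAlgebra 2] P₀) {G₁ : IwasawaAlgebra 2}
    (h : ∃ z ∈ Z, ∃ s : IwasawaAlgebra 2, s ∉ IwasawaAlgebra.augIdealP 2 ∧ col (ℓ₀ z) = s * G₁) :
    ∃ s : IwasawaAlgebra 2, s ∉ IwasawaAlgebra.augIdealP 2 ∧ s * G₁ ∈ Submodule.map (col ∘ₗ ℓ₀) Z := by
  obtain ⟨z, hz, s, hs, hzs⟩ := h
  exact ⟨s, hs, ⟨z, hz, hzs⟩⟩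

end Image

/-! ## §3 Per datum: the socket from a local Coleman dual pair at `2`, reciprocity and the image clause -/

section PerDatum

variable {W : WeierstrassCurve ℚ} [W.IsElliptic] [W.IsGloballyMinimal]
  [ContinuousSMul ℤ_[2] (W.tateModule 2)] [Module.Free ℤ_[2] (W.tateModule 2)]
  [Module.Finite ℤ_[2] (W.tateModule 2)] {N : ℕ} {f : CuspForm (Gamma0 N) 2}
  {κ : ZpExtension ℚ 2} {γ : absoluteGaloisGroup ℚ} {hκ : κ.IsCyclotomic}

/-- **SOCKET 2 (F1μ) per datum from Kato's machine at `2` in coordinates — the Selmer side is KERNEL.** Data and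
hypotheses (all explicit; nothing asserted): the pinned `I` (`𝐇¹_Γ(T₂W)`) and a submodule `Z ⊆ 𝐇¹` inside the span of
GENUINE `2`-adic Euler-system classes (Thm. 12.6); (L) a local Coleman dual pair at `2` — a `Λ`-module `P₀` in
axiomatic Pontryagin duality `hP : IsDualPair 2 ψ toDualP` with an abelian group `S` (in print `H¹_f(ℚ_{∞,2}, E[2^∞])`,
`P₀ = H¹_s`), an injective `Λ`-linear `col : P₀ → Λ` (Prop. 17.11 at `2`), an additive `φ : Sel_{2^∞}(E/ℚ_∞) → S`
intertwining `conj_γ − 1` with `ψ` (in print `loc₂`) with `ker φ = Sel₀(ℚ_∞, E[2^∞])` EXACTLY (`hker`); (R) a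
`Λ`-linear `ℓ₀ : 𝐇¹ → P₀` with `toDualP (ℓ₀ z) (φ s) = 0` for `z ∈ Z`, `s ∈ Sel` (Poitou–Tate at `2`, `Δ_W < 0`);
(E) the image clause at `(2)` for `col ∘ ℓ₀`. CONCLUSION: `HasZetaColemanMuInputsAtTwo W f κ γ hκ D Y` for EVERY Selmer
dual datum `D` and EVERY fine dual datum `Y` (any key `γ`): `P := range col`, `ℓ := col ∘ ℓ₀`, `τ := τ₀ ∘ col⁻¹` with
`τ₀` the `Λ`-linear transpose of `φ` (`IsDualPair.exists_linearMap_comp`), `π` the canonical transpose of `Sel₀ ≤ Sel`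
(`FineSelmerDualData.exists_linearMap_ofSelmerDual`); (b) by `transpose_eq_zero_of_pairing_eq_zero`, (c) by construction,
(d) by `exact_transpose_of_ker_eq_range`. Kernel; the three inputs (L)(R)(E) are exactly the beyond-print content left.
[cite: Kato2004Asterisque, Thm. 12.6 (p. 222), (14.9.3) (p. 240), Prop. 17.11 (p. 277), §17.13 (pp. 279–280)]
[cite: Kim2022StructureSelmer, §1.2.4] [cite: GreenbergLNM1716, §1 p. 60] -/
theorem hasZetaColemanMuInputsAtTwo_of_localDualPair (D : W.SelmerDualData κ γ) (Y : W.FineSelmerDualData κ γ)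
    (I : IwasawaH1Data W 2 κ γ) (Z : Submodule (IwasawaAlgebra 2) I.H)
    (hZ : Z ≤ Submodule.span (IwasawaAlgebra 2) {s : I.H | IsEulerSystemClassTwo W hκ I s})
    {P₀ : Type*} [AddCommGroup P₀] [Module (IwasawaAlgebra 2) P₀] {S : Type*} [AddCommGroup S]
    {ψ : AddMonoid.End S} {toDualP : P₀ →+ (S →+ AddCircle (1 : ℚ))} (hP : IsDualPair 2 ψ toDualP)
    (col : P₀ →ₗ[IwasawaAlgebra 2] IwasawaAlgebra 2) (hcol : Function.Injective col)
    (φ : W.selmerInfty κ →+ S) (hφ : ∀ s, φ ((W.conjSelmerInfty κ γ - 1) s) = ψ (φ s))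
    (hker : ∀ s : W.selmerInfty κ, φ s = 0 ↔ (s : W.subgroupH1 2 κ.kerSubgroup) ∈ W.fineSelmerInfty κ)
    (ℓ₀ : I.H →ₗ[IwasawaAlgebra 2] P₀)
    (hrec : ∀ z ∈ Z, ∀ s : W.selmerInfty κ, toDualP (ℓ₀ z) (φ s) = 0)
    (himg : ∀ G₁ : IwasawaAlgebra 2,
      iwasawaToPowerSeries 2 G₁ = padicLFunction f (unitRoot W 2 : ℚ_[2]) →
        ∃ s : IwasawaAlgebra 2, s ∉ IwasawaAlgebra.augIdealP 2 ∧
          s * G₁ ∈ Submodule.map (col ∘ₗ ℓ₀) Z) :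
    HasZetaColemanMuInputsAtTwo W f κ γ hκ D Y := by
  -- the transpose `τ₀ : P₀ → X` of `φ = loc₂` (Λ-linear) and the canonical fine quotient `π : X ↠ X₀`
  obtain ⟨τ₀, hτ₀⟩ := hP.exists_linearMap_comp (D.isDualPair' W κ) φ hφ
  obtain ⟨π, hπs, hπ⟩ := WeierstrassCurve.FineSelmerDualData.exists_linearMap_ofSelmerDual W κ D Y
  -- the kernel of `φ` is the range of the inclusion `Sel₀ ≤ Sel`
  have hker' : ∀ s : W.selmerInfty κ,
      φ s = 0 ↔ s ∈ (AddSubgroup.inclusion (W.fineSelmerInfty_le_selmerInfty κ)).range := by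
    intro s
    rw [hker, AddMonoidHom.mem_range]
    constructor
    · intro hs
      exact ⟨⟨(s : W.subgroupH1 2 κ.kerSubgroup), hs⟩, Subtype.ext rfl⟩
    · rintro ⟨s₀, rfl⟩
      exact s₀.2
  have hexact : Function.Exact τ₀ π :=
    exact_transpose_of_ker_eq_range D.bijective Y.bijective.1 hP.bijective.2
      (AddSubgroup.inclusion (W.fineSelmerInfty_le_selmerInfty κ)) φ hker' hπ hτ₀
  -- Coleman coordinates: `P := range col ≅ P₀`
  let e : P₀ ≃ₗ[IwasawaAlgebra 2] LinearMap.range col := LinearEquiv.ofInjective col hcol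
  have he : ∀ x : P₀, e.symm (col.rangeRestrict x) = x := fun x => by
    rw [LinearEquiv.symm_apply_eq]
    ext
    simp [e, LinearEquiv.ofInjective_apply]
  refine ⟨I, Z, LinearMap.range col, col.rangeRestrict ∘ₗ ℓ₀, τ₀ ∘ₗ e.symm.toLinearMap, π, hZ, ?_, hπs, ?_, ?_⟩
  · -- (b) `τ (ℓ z) = 0` on `Z`: reciprocity
    intro z hz
    change τ₀ (e.symm (col.rangeRestrict (ℓ₀ z))) = 0
    rw [he]
    exact transpose_eq_zero_of_pairing_eq_zero D.bijective.1 φ hτ₀ (hrec z hz)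
  · -- (d) exactness at `X`
    rw [LinearMap.exact_iff] at hexact ⊢
    rw [hexact, LinearMap.range_comp_of_range_eq_top _ e.symm.range]
  · -- (e) the image clause, transported to `range col`
    intro G₁ hG₁
    obtain ⟨s, hs, hsG⟩ := himg G₁ hG₁
    refine ⟨s, hs, ?_⟩
    have hcomp : (LinearMap.range col).subtype ∘ₗ (col.rangeRestrict ∘ₗ ℓ₀) = col ∘ₗ ℓ₀ := by
      ext z
      rfl
    rwa [hcomp]

/-- **SOCKET 2 (F1μ) per datum, GENERATOR form** — the shape in which Kato's construction is consumed: a SET `G ⊆ 𝐇¹` of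
genuine `2`-adic Euler-system classes (the Λ-adic lifts of the integral `(c, d, α)` / `(c, d, a(A))`-systems,
`isEulerSystemClassTwo_of_zetaBody`), `Z := Λ·G`; the reciprocity (R) is required only on the members of `G` (it propagates
to `Z` by `pairing_eq_zero_of_mem_span`, the transpose being `Λ`-linear), and the image clause (E) is required in its
ONE-CLASS form: some `g ∈ G` has `col (ℓ₀ g) = s·G₁` with `s ∉ (2)` (`imageClauseAtTwo_of_single_class`). The local
Coleman dual pair (L) is as in `hasZetaColemanMuInputsAtTwo_of_localDualPair`. Kernel; nothing asserted.
[cite: Kato2004Asterisque, Thm. 12.6 (p. 222), (14.9.3) (p. 240), Thm. 16.6 (2) (p. 271), Prop. 17.11 (p. 277), §17.13 (pp. 279–280)] -/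
theorem hasZetaColemanMuInputsAtTwo_of_localDualPair_generators (D : W.SelmerDualData κ γ)
    (Y : W.FineSelmerDualData κ γ) (I : IwasawaH1Data W 2 κ γ) (G : Set I.H)
    (hG : ∀ g ∈ G, IsEulerSystemClassTwo W hκ I g)
    {P₀ : Type*} [AddCommGroup P₀] [Module (IwasawaAlgebra 2) P₀] {S : Type*} [AddCommGroup S]
    {ψ : AddMonoid.End S} {toDualP : P₀ →+ (S →+ AddCircle (1 : ℚ))} (hP : IsDualPair 2 ψ toDualP)
    (col : P₀ →ₗ[IwasawaAlgebra 2] IwasawaAlgebra 2) (hcol : Function.Injective col)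
    (φ : W.selmerInfty κ →+ S) (hφ : ∀ s, φ ((W.conjSelmerInfty κ γ - 1) s) = ψ (φ s))
    (hker : ∀ s : W.selmerInfty κ, φ s = 0 ↔ (s : W.subgroupH1 2 κ.kerSubgroup) ∈ W.fineSelmerInfty κ)
    (ℓ₀ : I.H →ₗ[IwasawaAlgebra 2] P₀)
    (hrecG : ∀ g ∈ G, ∀ s : W.selmerInfty κ, toDualP (ℓ₀ g) (φ s) = 0)
    (himgG : ∀ G₁ : IwasawaAlgebra 2,
      iwasawaToPowerSeries 2 G₁ = padicLFunction f (unitRoot W 2 : ℚ_[2]) →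
        ∃ g ∈ G, ∃ s : IwasawaAlgebra 2, s ∉ IwasawaAlgebra.augIdealP 2 ∧ col (ℓ₀ g) = s * G₁) :
    HasZetaColemanMuInputsAtTwo W f κ γ hκ D Y := by
  -- any Λ-linear transpose of `φ` turns reciprocity on `G` into reciprocity on `Λ·G`
  obtain ⟨τ₀, hτ₀⟩ := hP.exists_linearMap_comp (D.isDualPair' W κ) φ hφ
  refine hasZetaColemanMuInputsAtTwo_of_localDualPair D Y I (Submodule.span (IwasawaAlgebra 2) G)
    (Submodule.span_mono fun g hg => hG g hg) hP col hcol φ hφ hker ℓ₀ ?_ ?_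
  · intro z hz s
    exact pairing_eq_zero_of_mem_span D.bijective.1 φ hτ₀ ℓ₀ hrecG hz s
  · intro G₁ hG₁
    obtain ⟨g, hg, s, hs, hgs⟩ := himgG G₁ hG₁
    exact imageClauseAtTwo_of_single_class _ col ℓ₀ ⟨g, Submodule.subset_span hg, s, hs, hgs⟩

end PerDatum

/-! ## §4 The ∀-form: the re-cut socket `ZetaColemanMuInputsNegDiscAtTwo` from a supply of local dual pairs -/

/-- **The re-cut SOCKET 2 `ZetaColemanMuInputsNegDiscAtTwo` (F1μ) from Kato's machine at `2` in coordinates, curve by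
curve.** If for every globally minimal `W`, good ordinary at `2`, `ρ̄_{W,2}` onto, `Δ_W < 0`, newform `f`, cyclotomic
`(κ, γ)` and every Selmer dual datum `D` there are `I`, `Z` in the span of genuine `2`-adic classes, a local Coleman dual
pair `(P₀, S, ψ, toDualP, col, φ)` at `2` with `ker φ = Sel₀`, a singular localisation `ℓ₀` with the reciprocity
`toDualP (ℓ₀ z) (φ s) = 0`, and the image clause at `(2)` — the hypothesis `hsupply`, i.e. (L) + (R) + (E) of the module
docstring on the habitat — then `ZetaColemanMuInputsNegDiscAtTwo` holds (the fine datum `Y` is not an input). Kernel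
implication; the supply is the OPEN content (Kato 17.9/17.11, Poitou–Tate and 16.6 (2) AT `p = 2`), nothing asserted.
[cite: Kato2004Asterisque, Thm. 12.6 (p. 222), (14.9.3) (p. 240), Thm. 16.6 (p. 271), Prop. 17.11 (p. 277), §17.13 (pp. 279–280)] -/
theorem zetaColemanMuInputsNegDiscAtTwo_of_localDualPairs
    (hsupply : ∀ (W : WeierstrassCurve ℚ) [W.IsElliptic] [W.IsGloballyMinimal]
      [ContinuousSMul ℤ_[2] (W.tateModule 2)] [Module.Free ℤ_[2] (W.tateModule 2)]
      [Module.Finite ℤ_[2] (W.tateModule 2)] {N : ℕ} [NeZero N] (f : CuspForm (Gamma0 N) 2)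
      (κ : ZpExtension ℚ 2) (γ : absoluteGaloisGroup ℚ) (hκ : κ.IsCyclotomic),
      IsOrdinaryAt W 2 → W.HasSurjectiveModNGaloisRep 2 → W.Δ < 0 →
      κ.IsTopGenerator γ → IsCyclotomicVariable 2 γ → IsNewformOf W f →
      ∀ (D : W.SelmerDualData κ γ),
        ∃ (I : IwasawaH1Data W 2 κ γ) (Z : Submodule (IwasawaAlgebra 2) I.H)
          (P₀ : Type) (_ : AddCommGroup P₀) (_ : Module (IwasawaAlgebra 2) P₀)
          (S : Type) (_ : AddCommGroup S) (ψ : AddMonoid.End S) (toDualP : P₀ →+ (S →+ AddCircle (1 : ℚ)))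
          (col : P₀ →ₗ[IwasawaAlgebra 2] IwasawaAlgebra 2) (φ : W.selmerInfty κ →+ S)
          (ℓ₀ : I.H →ₗ[IwasawaAlgebra 2] P₀),
          Z ≤ Submodule.span (IwasawaAlgebra 2) {s : I.H | IsEulerSystemClassTwo W hκ I s} ∧
          IsDualPair 2 ψ toDualP ∧ Function.Injective col ∧
          (∀ s, φ ((W.conjSelmerInfty κ γ - 1) s) = ψ (φ s)) ∧
          (∀ s : W.selmerInfty κ, φ s = 0 ↔ (s : W.subgroupH1 2 κ.kerSubgroup) ∈ W.fineSelmerInfty κ) ∧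
          (∀ z ∈ Z, ∀ s : W.selmerInfty κ, toDualP (ℓ₀ z) (φ s) = 0) ∧
          ∀ G₁ : IwasawaAlgebra 2,
            iwasawaToPowerSeries 2 G₁ = padicLFunction f (unitRoot W 2 : ℚ_[2]) →
              ∃ s : IwasawaAlgebra 2, s ∉ IwasawaAlgebra.augIdealP 2 ∧
                s * G₁ ∈ Submodule.map (col ∘ₗ ℓ₀) Z) :
    ZetaColemanMuInputsNegDiscAtTwo := by
  intro W _ _ _ _ _ N _ f κ γ hκ hord h2 hΔ hγ hγ' hf D Y
  obtain ⟨I, Z, P₀, instP₀, instP₀', S, instS, ψ, toDualP, col, φ, ℓ₀, hZ, hP, hcol, hφ, hker, hrec,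
    himg⟩ := hsupply W f κ γ hκ hord h2 hΔ hγ hγ' hf D
  exact hasZetaColemanMuInputsAtTwo_of_localDualPair D Y I Z hZ hP col hcol φ hφ hker ℓ₀ hrec himg

end Summit.BirchSwinnertonDyer.BirchSwinnertonDyer.Theorems.SteinbergFibreAtTwo

end
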